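import Mathlib
import HarnessLib
import Summits.HubbardSuperconductivity.HubbardSuperconductivity.Theorems.KLProgrammeFermiSurfaceTwoLoopAngular
import Summits.HubbardSuperconductivity.HubbardSuperconductivity.Theorems.KLProgrammeFermiSurfaceTwoLoopPolar

/-!
# Route `KLProgramme` (cruxes K3/K1, risk r2) — FST II Theorem 1.1 (two-loop volume) for the Hubbard band, part 7:
# THE THEOREM — `𝓦(ε) ≤ Q ε |log ε|` for `ε = -2(cos k₁ + cos k₂)` on every compact level range in `(-4, 0)`

Cell `gate-hubbard-kl`, seat fs-1 (g5), risk-register item r2 «Fermi-surface hypotheses on the window». Feldman–Salmhofer–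
Trubowitz II (CPAM 51 (1998) 1133), Theorem 1.1, `d = 2` clause: the two-loop phase-space volume
`𝓦(ε) = sup_{q} max_{v₁,v₂=±1} ∫_{S×S} 𝟙(|e(v₁p₁ + v₂p₂ + q)| ≤ ε)` is `≤ Q ε|log ε|`. In the tree it is the NAMED
FACT `FermiRG.VolumeBound` (F-026, `FST2Regularity.lean`; general (A2)–(A4) bands, not proved); FS-WINDOW.md §5 recorded
the Hubbard band as an instance with all hypotheses discharged and the conclusion CONDITIONAL on the fact
(`klfs_fst2_volumeBound_hubbard`, p427907). This file PROVES the conclusion for the Hubbard band, unconditionally: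

* `kltl_exists_volW_le` — for `-4 < a ≤ b < 0` there is `Q ≥ 1` with
  `FermiRG.volW (Crystal.cubic 2) (ε - μ) ε' ≤ Q ε' |log ε'|` for all `μ ∈ [a, b]`, `0 < ε' ≤ 1/2`;
* `kltl_volW_le_hubbard` (every single level `-4 < μ < 0`), `kltl_windows_volW_le` (ONE `Q` on the certified window
  `[-0.4267, -0.1798]` and ONE on the leaf's analysis window `[-1, -0.15]`);
* `kltl_fst2_theorem11_d2_hubbard` — the `d = 2` clause of `VolumeBound`'s conclusion in its printed shape, with
  `Module.finrank ℝ Momentum = 2`, for the Hubbard datum — no hypothesis `VolumeBound`.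

Proof (parts 1–6: `…TwoLoopLevel/Window/Caustic/Polar/Dyadic/Angular.lean`): polar coordinates turn `𝓦` into
`≤ 2π² ·` an iterated angular integral (`kltl_volW_le_of_angular`, the tree's area formula); the inner integral is p1b's
Lemma E.1/E.3 family (Cooper law `Cδ/|w|_𝕋`, uniform law `C₁δ + C₂√δ`, caustic law `C₁δ + C₃δ/√r`); the outer variable
sees the Cooper point on `O(s)` and the doubled curve `2S_μ + c + 2πℤ²` on `O(√s)` of its period (exact trichotomy of the
three-leg caustic + compactness); two dyadic layer-cakes give `O(ε)` per scale and the logarithm is the number of scales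
(`kltl_exists_angular_bound`). Umklapp is allowed throughout (no (A5)): the caustic is taken modulo `2πℤ²`. Constants are
existential (compactness), as in the typed fact. No definitions; everything PROVED. [folklore]
-/

noncomputable section

open Real Set MeasureTheory
open scoped ENNReal

-- the tree's namespace `Summit.<Summit>.<Problem>.Theorems` repeats the summit name by design (D-0017)
set_option linter.dupNamespace false

namespace Summit.HubbardSuperconductivity.HubbardSuperconductivity.Theorems

open Literature.MathematicalPhysics.QuantumLattice
open Literature.MathematicalPhysics.QuantumLattice.BandSectorCounting

/-- **FST II Theorem 1.1 for the Hubbard band (two-loop volume bound, `d = 2`).** For every compact level range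
`[a, b] ⊂ (-4, 0)` there is `Q ≥ 1` such that `𝓦(ε') ≤ Q ε' |log ε'|` for all `μ ∈ [a, b]` and `0 < ε' ≤ 1/2`, where
`𝓦 = FermiRG.volW (Crystal.cubic 2) (ε - μ)` is FST's two-loop volume of the band `ε = -2(cos k₁ + cos k₂)`. [folklore] -/
theorem kltl_exists_volW_le {a b : ℝ} (ha : -4 < a) (hab : a ≤ b) (hb : b < 0) :
    ∃ Q : ℝ, 1 ≤ Q ∧ ∀ μ ∈ Icc a b, ∀ ε' : ℝ, 0 < ε' → ε' ≤ 1 / 2 →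
      FermiRG.volW (FermiRG.Crystal.cubic 2) (fun q : Momentum => squareDispersion 1 0 q - μ) ε' ≤
        ENNReal.ofReal (Q * ε' * |Real.log ε'|) := by
  have hπ := Real.pi_pos
  obtain ⟨Qa, hQa, hang⟩ := kltl_exists_angular_bound ha hab hb
  refine ⟨max 1 (2 * π ^ 2 * Qa), le_max_left _ _, fun μ hμ ε' hε hε2 => ?_⟩
  have hμ₁ : -4 < μ := ha.trans_le hμ.1
  have hμ₂ : μ < 0 := hμ.2.trans_lt hb
  have hL : 0 ≤ |Real.log ε'| := abs_nonneg _
  have hM : ∀ τ : ℝ, (τ = 1 ∨ τ = -1) → ∀ q₁ q₂ : ℝ,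
      ∫⁻ θ₁ in Icc (-π) π, volume {θ₂ ∈ Icc (-π) π |
          |eps2 (bandX μ θ₂ - (τ * bandX μ θ₁ + q₁)) (bandY μ θ₂ - (τ * bandY μ θ₁ + q₂)) - μ| ≤ ε'} ≤
        ENNReal.ofReal (Qa * ε' * |Real.log ε'|) := by
    intro τ hτ q₁ q₂
    have h := hang μ hμ τ hτ q₁ q₂ (-π) ε' hε hε2
    have e : -π + 2 * π = π := by ring
    rw [e] at h
    exact h
  refine (kltl_volW_le_of_angular hμ₁ hμ₂ ε' _ hM).trans ?_
  rw [← ENNReal.ofReal_mul (by positivity)]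
  apply ENNReal.ofReal_le_ofReal
  have h1 : 2 * π ^ 2 * (Qa * ε' * |Real.log ε'|) = (2 * π ^ 2 * Qa) * (ε' * |Real.log ε'|) := by ring
  have h2 : max 1 (2 * π ^ 2 * Qa) * ε' * |Real.log ε'| = max 1 (2 * π ^ 2 * Qa) * (ε' * |Real.log ε'|) := by ring
  rw [h1, h2]
  exact mul_le_mul_of_nonneg_right (le_max_right _ _) (by positivity)

/-- **Every single hole-doped level** `-4 < μ < 0` has a two-loop volume constant. [folklore] -/
theorem kltl_volW_le_hubbard {μ : ℝ} (hμ₁ : -4 < μ) (hμ₂ : μ < 0) :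
    ∃ Q : ℝ, 1 ≤ Q ∧ ∀ ε' : ℝ, 0 < ε' → ε' ≤ 1 / 2 →
      FermiRG.volW (FermiRG.Crystal.cubic 2) (fun q : Momentum => squareDispersion 1 0 q - μ) ε' ≤
        ENNReal.ofReal (Q * ε' * |Real.log ε'|) := by
  obtain ⟨Q, hQ, h⟩ := kltl_exists_volW_le hμ₁ le_rfl hμ₂
  exact ⟨Q, hQ, fun ε' hε hε2 => h μ ⟨le_rfl, le_rfl⟩ ε' hε hε2⟩

/-- **ONE constant on each programme window**: the certified window `μ ∈ [-0.4267, -0.1798]` (`δ ∈ [0.10, 0.20]`) and the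
leaf's analysis window `μ ∈ [-1, -0.15]` (`δ ∈ [0.10, 0.35]`, S0). [folklore] -/
theorem kltl_windows_volW_le :
    (∃ Q : ℝ, 1 ≤ Q ∧ ∀ μ ∈ Icc (-0.4267 : ℝ) (-0.1798), ∀ ε' : ℝ, 0 < ε' → ε' ≤ 1 / 2 →
      FermiRG.volW (FermiRG.Crystal.cubic 2) (fun q : Momentum => squareDispersion 1 0 q - μ) ε' ≤
        ENNReal.ofReal (Q * ε' * |Real.log ε'|)) ∧
    (∃ Q : ℝ, 1 ≤ Q ∧ ∀ μ ∈ Icc (-1 : ℝ) (-0.15), ∀ ε' : ℝ, 0 < ε' → ε' ≤ 1 / 2 →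
      FermiRG.volW (FermiRG.Crystal.cubic 2) (fun q : Momentum => squareDispersion 1 0 q - μ) ε' ≤
        ENNReal.ofReal (Q * ε' * |Real.log ε'|)) :=
  ⟨kltl_exists_volW_le (by norm_num) (by norm_num) (by norm_num),
   kltl_exists_volW_le (by norm_num) (by norm_num) (by norm_num)⟩

/-- **FST II Theorem 1.1, `d = 2` clause, in the printed shape of `FermiRG.VolumeBound`'s conclusion, for the Hubbard
datum on a level range** — unconditionally (compare the conditional instance `klfs_fst2_volumeBound_hubbard`). [folklore] -/
theorem kltl_fst2_theorem11_d2_hubbard {a b : ℝ} (ha : -4 < a) (hab : a ≤ b) (hb : b < 0) :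
    ∃ Q : ℝ, 1 ≤ Q ∧ ∀ μ ∈ Icc a b, ∀ ε' : ℝ, 0 < ε' → ε' ≤ 1 / 2 →
      (Module.finrank ℝ Momentum = 2 →
        FermiRG.volW (FermiRG.Crystal.cubic 2) (fun q : Momentum => squareDispersion 1 0 q - μ) ε' ≤
          ENNReal.ofReal (Q * ε' * |Real.log ε'|)) := by
  obtain ⟨Q, hQ, h⟩ := kltl_exists_volW_le ha hab hb
  exact ⟨Q, hQ, fun μ hμ ε' hε hε2 _ => h μ hμ ε' hε hε2⟩

end Summit.HubbardSuperconductivity.HubbardSuperconductivity.Theorems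

end
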